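import Literature.NumberTheory.Automorphic.GL2CasimirScalar
import HarnessLib

/-!
# Two real Casimir elements of `U_ℝ(𝔤𝔩ₙ(ℂ))`, the factorisation `ρ = L + R ∘ conj` of a real
# `𝔤𝔩ₙ(ℂ)`-module, and the scalars `s₁ + s₂`, `s₁² + s₂² - ½` / `t₁ + t₂`, `t₁² + t₂² - ½` on a `𝔤𝔩₂(ℂ)`-module of
# Harish-Chandra parameter `χ(id) = {s₁, s₂}`, `χ(conj) = {t₁, t₂}` (Knapp 2002, Thm. 5.44 at `𝕜 = ℂ`)

Topic `NumberTheory/Automorphic`; the `𝕜 = ℂ` companion of `GL2CasimirScalar` (which treats `𝕜 = ℝ`: the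
Casimir element `∑ E_{ab}E_{ba}` and `Z = ι(1)` of `U(𝔤𝔩₂(ℝ))` act on a module of Harish-Chandra parameter
`{s₁, s₂}` by `s₁² + s₂² - ½` and `s₁ + s₂`). For `𝕜 = ℂ` the predicate `HasHCParameter ρ χ` of `HarishChandraGL`
concerns a REAL Lie algebra homomorphism `ρ : 𝔤𝔩ₙ(ℂ) →ₗ⁅ℝ⁆ End_ℂ V` and the centre of the REAL enveloping
algebra `U_ℝ(𝔤𝔩ₙ(ℂ))`, and the parameter is indexed by the two real-algebra embeddings `τ ∈ {id, conj}` of `ℂ`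
(the complexification `𝔤𝔩ₙ(ℂ) ⊗_ℝ ℂ ≅ 𝔤𝔩ₙ(ℂ)_{id} × 𝔤𝔩ₙ(ℂ)_{conj}`, Knapp 2002, §VI.1). This file supplies the
dictionary to explicit operators (consumed at a complex place by the `(𝔤, K)`-module arguments of the Langlands
summit, e.g. the integral pairing `s_i - t_j ∈ ℤ` of Clozel 1990, §3.3):

* `GLnComplexCasimir.gen`, `casU`, `casPlus n = C₊ = ∑_{a,b} (ι(E_{ab}) ι(E_{ba}) - ι(iE_{ab}) ι(iE_{ba}))`,
  `casMinus n = C₋ = ∑_{a,b} (ι(E_{ab}) ι(iE_{ba}) + ι(iE_{ab}) ι(E_{ba}))`, `zedU n u = ι(u · 1)` — central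
  elements of `U_ℝ(𝔤𝔩ₙ(ℂ))` (`casPlus_mem_center`, `casMinus_mem_center`, `zedU_mem_center`): `C₊`, `C₋` are the
  Casimir elements of the invariant real forms `Re tr(XY)`, `Im tr(XY)` (Knapp 2002, §V.4); centrality is proved
  directly, following `casimirU_mem_center` of `RealCasimirGL` (there for the Lie algebra of
  `RealMatrixGroup.gl A N`): the four sums of the commutator with a generator `ι(x E_{cd})` (`gen_comm_casU`)
  cancel in pairs by the Frobenius identities of `1 ⊗ 1 - i ⊗ i`, `1 ⊗ i + i ⊗ 1 ∈ ℂ ⊗_ℝ ℂ`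
  (`frobenius_re`, `frobenius_im`);
* through the real form `ρ = ∑_τ Ψ_τ ∘ τ` of a factorwise representation `Ψ : HCWt.FactorRep ℂ n V` of
  `𝔤𝔩ₙ(ℂ)_ℂ`, with per-factor Casimir operators `cas Ψ τ = ∑_{a,b} Ψ_τ(E_{ab}) Ψ_τ(E_{ba})`:
  `C₊ ↦ 2 (C_id + C_conj)`, `C₋ ↦ 2i (C_id - C_conj)`, `Z(u) ↦ u Ψ_id(1) + ū Ψ_conj(1)` (`lift_casPlus`,
  `lift_casMinus`, `lift_zedU`);
* **the factorisation of a real representation** `ρ` of `𝔤𝔩ₙ(ℂ)`: the `τ`-projectors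
  `tauProj ρ τ X = ½ (ρ X + conj(τ i) ρ(iX))` (the operator form of `HCEmb.proj`) assemble to a factorwise
  representation `ofRho ρ`, `Φ_τ(Y) = P_τ(τ Y)`, i.e. `L X = ½ (ρ X - i ρ(iX))`, `R Y = ½ (ρ Ȳ + i ρ(i Ȳ))`:
  complex-linear Lie algebra homomorphisms with `[L X, R Y] = 0` (`tauProj_mul_tauProj_sub`) and real form `ρ`
  (`ofRho_rho`), `ρ X = L X + R X̄` (`rho_eq_add`) — Knapp 2002, §VI.1;
* `n = 2` (`GL2ComplexCasimir`): the Harish-Chandra polynomials `γ(C₊)(x) = 2 ∑_τ (x_{τ,0}² + x_{τ,1}² - ½)`,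
  `γ(C₋)(x) = 2i ((x_{id,0}² + x_{id,1}² - ½) - (x_{conj,0}² + x_{conj,1}² - ½))`,
  `γ(Z(u))(x) = u (x_{id,0} + x_{id,1}) + ū (x_{conj,0} + x_{conj,1})` (evaluate on the highest weight vector
  `HCModel.hwVec (x - ρ)` of the model, as `GL2Casimir.aeval_harishChandra_casimirZ`), and
  **`scalars_of_hasHCParameter`**: on a module of parameter `χ`, `χ(id) = {s₁, s₂}`, `χ(conj) = {t₁, t₂}`,
  `L(1) = s₁ + s₂`, `∑ L(E_{ab}) L(E_{ba}) = s₁² + s₂² - ½`, `R(1) = t₁ + t₂`, `∑ R(E_{ab}) R(E_{ba}) = t₁² + t₂² - ½`.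

Everything is proved; the definitions are the named elements and operators above.

## References

* A. W. Knapp, *Lie Groups Beyond an Introduction*, 2nd ed. (2002), §V.4 (Prop. 5.24, (5.24)), §V.5 (Thm. 5.44),
  §VI.1. [Knapp2002]
* L. Clozel, *Motifs et formes automorphes* (1990), §3.3. [Clozel1990]
-/

noncomputable section

-- Mathlib idiom (Mathlib/Algebra/Lie/OfAssociative.lean), as in `GL2CasimirScalar` and `HarishChandraGL`: commutator
-- brackets on matrix algebras and on `Module.End` (the Lie algebras `𝔤𝔩ₙ(ℂ)` and `End_ℂ V` of `HasHCParameter`).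
attribute [local instance 100] LieRing.ofAssociativeRing

open scoped Matrix ComplexConjugate
open UniversalEnvelopingAlgebra Complex

namespace Literature.NumberTheory.Automorphic

namespace GLnComplexCasimir

/-- The conjugation `ℂ → ℂ` as a real algebra homomorphism (local notation). -/
local notation "σ⁻" => (Complex.conjAe : ℂ →ₐ[ℝ] ℂ)
/-- The identity `ℂ → ℂ` as a real algebra homomorphism (local notation). -/
local notation "σ⁺" => AlgHom.id ℝ ℂ

/-! ### The two real-algebra endomorphisms of `ℂ` -/

/-- `conj(i) = -i` through the coercion `conjAe : ℂ →ₐ[ℝ] ℂ`. [folklore] -/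
theorem conjAe_I : σ⁻ I = -I := Complex.conj_I

/-- `id ≠ conj` as real algebra endomorphisms of `ℂ`. [folklore] -/
theorem id_ne_conjAe : σ⁺ ≠ σ⁻ := fun h => by
  have h1 : (I : ℂ) = -I := by simpa [conjAe_I] using congrArg (fun f : ℂ →ₐ[ℝ] ℂ => f I) h
  exact I_ne_zero (by linear_combination h1 / 2)

open scoped Classical in
/-- The real algebra endomorphisms of `ℂ` are `id` and `conj` (`Complex.real_algHom_eq_id_or_conj`).
[folklore] -/
theorem univ_algHom : (Finset.univ : Finset (ℂ →ₐ[ℝ] ℂ)) = {σ⁺, σ⁻} := by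
  ext τ
  simp only [Finset.mem_univ, Finset.mem_insert, Finset.mem_singleton, true_iff]
  exact Complex.real_algHom_eq_id_or_conj τ

/-- Sums over the real algebra endomorphisms of `ℂ`: `∑_τ f τ = f(id) + f(conj)`. [folklore] -/
theorem sum_algHom {M : Type*} [AddCommMonoid M] (f : (ℂ →ₐ[ℝ] ℂ) → M) :
    ∑ τ, f τ = f σ⁺ + f σ⁻ := by
  classical
  rw [univ_algHom, Finset.sum_pair id_ne_conjAe]

/-- Every real algebra endomorphism of `ℂ` is an involution. [folklore] -/
theorem algHom_algHom (τ : ℂ →ₐ[ℝ] ℂ) (a : ℂ) : τ (τ a) = a := by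
  rcases Complex.real_algHom_eq_id_or_conj τ with rfl | rfl
  · rfl
  · exact Complex.conj_conj a

/-- `conj(τ i)² = -1` for every real algebra endomorphism `τ` of `ℂ`. [folklore] -/
theorem conj_algHom_I_mul_self (τ : ℂ →ₐ[ℝ] ℂ) : conj (τ I) * conj (τ I) = -1 := by
  rw [← map_mul, ← map_mul, I_mul_I, map_neg, map_one, map_neg, map_one]

/-- Distinct real algebra endomorphisms of `ℂ` take opposite values at `i`. [folklore] -/
theorem algHom_I_eq_neg {τ τ' : ℂ →ₐ[ℝ] ℂ} (h : τ ≠ τ') : τ' I = -τ I := by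
  rcases Complex.real_algHom_eq_id_or_conj τ with rfl | rfl <;>
    rcases Complex.real_algHom_eq_id_or_conj τ' with rfl | rfl
  · exact absurd rfl h
  · exact conjAe_I
  · rw [conjAe_I, neg_neg]; rfl
  · exact absurd rfl h

/-- `τ(a • X) = τ(a) • τ(X)` for matrices. [folklore] -/
theorem mapMatrix_smul {n : ℕ} (τ : ℂ →ₐ[ℝ] ℂ) (a : ℂ) (X : Matrix (Fin n) (Fin n) ℂ) :
    τ.mapMatrix (a • X) = τ a • τ.mapMatrix X := by
  ext j k
  simp [Matrix.map_apply]

/-- `τ(τ(X)) = X` for matrices. [folklore] -/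
theorem mapMatrix_mapMatrix {n : ℕ} (τ : ℂ →ₐ[ℝ] ℂ) (X : Matrix (Fin n) (Fin n) ℂ) :
    τ.mapMatrix (τ.mapMatrix X) = X := by
  ext j k
  simp [Matrix.map_apply, algHom_algHom]

/-- `τ [X, Y] = [τ X, τ Y]` for matrices. [folklore] -/
theorem mapMatrix_lie {n : ℕ} (τ : ℂ →ₐ[ℝ] ℂ) (X Y : Matrix (Fin n) (Fin n) ℂ) :
    τ.mapMatrix ⁅X, Y⁆ = ⁅τ.mapMatrix X, τ.mapMatrix Y⁆ := by
  rw [Ring.lie_def, Ring.lie_def, map_sub, map_mul, map_mul]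

/-! ### Two real Casimir elements and the centre of `𝔤𝔩ₙ(ℂ)` inside `U_ℝ(𝔤𝔩ₙ(ℂ))` -/

section Central

open HCSpan

variable {n : ℕ}

/-- The generator `x ↦ ι(x E_{ab})` of the real enveloping algebra `U_ℝ(𝔤𝔩ₙ(ℂ))`, real-linear in
`x ∈ ℂ` (cf. `genU` of `RealCasimirGL`). [folklore] -/
def gen (a b : Fin n) : ℂ →ₗ[ℝ] UGL ℂ n where
  toFun x := ιU (Matrix.single a b x)
  map_add' x y := by rw [Matrix.single_add, map_add]
  map_smul' r x := by rw [RingHom.id_apply, ← map_smul, Matrix.smul_single]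

/-- Unfolding `gen`. [folklore] -/
theorem gen_apply (a b : Fin n) (x : ℂ) : gen a b x = ιU (Matrix.single a b x) := rfl

/-- The commutation relation of two generators:
`ι(xE_{cd}) ι(yE_{ab}) - ι(yE_{ab}) ι(xE_{cd}) = δ_{da} ι((xy)E_{cb}) - δ_{bc} ι((yx)E_{ad})`.
[folklore] -/
theorem gen_comm (c d a b : Fin n) (x y : ℂ) :
    gen c d x * gen a b y - gen a b y * gen c d x =
      (if d = a then gen c b (x * y) else 0) - (if b = c then gen a d (y * x) else 0) := by
  simp only [gen_apply]
  rw [← Ring.lie_def, ← LieHom.map_lie, single_lie_single, map_sub]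
  congr 1 <;> split_ifs <;> simp

variable (n) in
/-- The quadratic element `S(u, u') = ∑_{a,b} ι(u E_{ab}) ι(u' E_{ba})` of `U_ℝ(𝔤𝔩ₙ(ℂ))`
(`u, u' ∈ ℂ`). [folklore] -/
def casU (u u' : ℂ) : UGL ℂ n := ∑ a : Fin n, ∑ b : Fin n, gen a b u * gen b a u'

/-- The commutator of a generator `ι(x E_{cd})` with `S(u, u')`: four single sums (verbatim the
computation `Literature.NumberTheory.Automorphic.genU_comm_sum_sq` of `RealCasimirGL`, with two units).
[folklore] -/
theorem gen_comm_casU (c d : Fin n) (x u u' : ℂ) :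
    gen c d x * casU n u u' - casU n u u' * gen c d x =
      (∑ b, gen c b (x * u) * gen b d u' - ∑ b, gen c b u * gen b d (u' * x)) +
        (∑ a, gen a d u * gen c a (x * u') - ∑ a, gen a d (u * x) * gen c a u') := by
  -- adapted from `genU_comm_sum_sq` (Literature/NumberTheory/Automorphic/RealCasimirGL.lean)
  have hcomm : ∀ P Q : UGL ℂ n, gen c d x * (P * Q) - (P * Q) * gen c d x =
      (gen c d x * P - P * gen c d x) * Q + P * (gen c d x * Q - Q * gen c d x) :=
    fun P Q ↦ by noncomm_ring
  rw [casU, Finset.mul_sum, Finset.sum_mul, ← Finset.sum_sub_distrib]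
  simp_rw [Finset.mul_sum, Finset.sum_mul, ← Finset.sum_sub_distrib, hcomm, gen_comm,
    sub_mul, mul_sub, ite_mul, mul_ite, zero_mul, mul_zero, Finset.sum_add_distrib,
    Finset.sum_sub_distrib]
  have e1 : ∑ a, ∑ b, (if d = a then gen c b (x * u) * gen b a u' else 0) =
      ∑ b, gen c b (x * u) * gen b d u' := by
    rw [Finset.sum_comm]
    simp_rw [Finset.sum_ite_eq, Finset.mem_univ, if_true]
  have e2 : ∑ a, ∑ b, (if b = c then gen a d (u * x) * gen b a u' else 0) =
      ∑ a, gen a d (u * x) * gen c a u' := by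
    simp_rw [Finset.sum_ite_eq', Finset.mem_univ, if_true]
  have e3 : ∑ a, ∑ b, (if d = b then gen a b u * gen c a (x * u') else 0) =
      ∑ a, gen a d u * gen c a (x * u') := by
    simp_rw [Finset.sum_ite_eq, Finset.mem_univ, if_true]
  have e4 : ∑ a, ∑ b, (if a = c then gen a b u * gen b d (u' * x) else 0) =
      ∑ b, gen c b u * gen b d (u' * x) := by
    rw [Finset.sum_comm]
    simp_rw [Finset.sum_ite_eq', Finset.mem_univ, if_true]
  rw [e1, e2, e3, e4]
  abel

/-- **Frobenius identity of `1 ⊗ 1 - i ⊗ i`** (the canonical element of the real form `Re(xy)` on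
`ℂ` commutes with `ℂ`): for every real-bilinear `β`, `β(x, 1) - β(xi, i) = β(1, x) - β(i, ix)`.
[folklore] -/
theorem frobenius_re {P : Type*} [AddCommGroup P] [Module ℝ P] (β : ℂ →ₗ[ℝ] ℂ →ₗ[ℝ] P) (x : ℂ) :
    β (x * 1) 1 - β 1 (1 * x) - (β (x * I) I - β I (I * x)) = 0 := by
  obtain ⟨a, b, rfl⟩ : ∃ a b : ℝ, x = a • (1 : ℂ) + b • I :=
    ⟨x.re, x.im, by rw [Complex.real_smul, Complex.real_smul, mul_one]; exact (re_add_im x).symm⟩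
  have h1 : (a • (1 : ℂ) + b • I) * I = a • I + (-b) • (1 : ℂ) := by
    apply Complex.ext <;> simp
  have h2 : I * (a • (1 : ℂ) + b • I) = a • I + (-b) • (1 : ℂ) := by rw [mul_comm]; exact h1
  rw [mul_one, one_mul, h1, h2]
  simp only [map_add, map_smul, LinearMap.add_apply, LinearMap.smul_apply]
  module

/-- **Frobenius identity of `1 ⊗ i + i ⊗ 1`** (the canonical element of the real form `Im(xy)`):
for every real-bilinear `β`, `β(x, i) + β(xi, 1) = β(1, ix) + β(i, x)`. [folklore] -/
theorem frobenius_im {P : Type*} [AddCommGroup P] [Module ℝ P] (β : ℂ →ₗ[ℝ] ℂ →ₗ[ℝ] P) (x : ℂ) :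
    β (x * 1) I - β 1 (I * x) + (β (x * I) 1 - β I (1 * x)) = 0 := by
  obtain ⟨a, b, rfl⟩ : ∃ a b : ℝ, x = a • (1 : ℂ) + b • I :=
    ⟨x.re, x.im, by rw [Complex.real_smul, Complex.real_smul, mul_one]; exact (re_add_im x).symm⟩
  have h1 : (a • (1 : ℂ) + b • I) * I = a • I + (-b) • (1 : ℂ) := by
    apply Complex.ext <;> simp
  have h2 : I * (a • (1 : ℂ) + b • I) = a • I + (-b) • (1 : ℂ) := by rw [mul_comm]; exact h1
  rw [mul_one, one_mul, h1, h2]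
  simp only [map_add, map_smul, LinearMap.add_apply, LinearMap.smul_apply]
  module

variable (n) in
/-- **The first real Casimir element** `C₊ = ∑_{a,b} (ι(E_{ab}) ι(E_{ba}) - ι(iE_{ab}) ι(iE_{ba}))` of
`𝔤𝔩ₙ(ℂ)` as a REAL Lie algebra: the Casimir element of the invariant form `Re tr(XY)` (dual bases
`E_{ab} ↔ E_{ba}`, `iE_{ab} ↔ -iE_{ba}`); it is `casimirU` of `RealCasimirGL` for `A = ℂ`.
Knapp 2002, §V.4, (5.24). [folklore] -/
def casPlus : UGL ℂ n := casU n 1 1 - casU n I I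

variable (n) in
/-- **The second real Casimir element** `C₋ = ∑_{a,b} (ι(E_{ab}) ι(iE_{ba}) + ι(iE_{ab}) ι(E_{ba}))`:
the Casimir element of the invariant form `Im tr(XY)` (dual bases `E_{ab} ↔ iE_{ba}`,
`iE_{ab} ↔ E_{ba}`). Knapp 2002, §V.4, (5.24). [folklore] -/
def casMinus : UGL ℂ n := casU n 1 I + casU n I 1

/-- Bookkeeping: `(B₁ + A₁) - (B₂ + A₂) = 0` from `B₁ - B₂ = 0` and `A₁ - A₂ = 0`. [folklore] -/
theorem sub_add_sub_aux {M : Type*} [AddCommGroup M] {B₁ A₁ B₂ A₂ : M} (hB : B₁ - B₂ = 0)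
    (hA : A₁ - A₂ = 0) : (B₁ + A₁) - (B₂ + A₂) = 0 := by
  rw [add_sub_add_comm, hB, hA, add_zero]

/-- Bookkeeping: `(B₁ + A₁) + (B₂ + A₂) = 0` from `B₁ + B₂ = 0` and `A₁ + A₂ = 0`. [folklore] -/
theorem add_add_add_aux {M : Type*} [AddCommGroup M] {B₁ A₁ B₂ A₂ : M} (hB : B₁ + B₂ = 0)
    (hA : A₁ + A₂ = 0) : (B₁ + A₁) + (B₂ + A₂) = 0 := by
  rw [add_add_add_comm, hB, hA, add_zero]

/-- **`C₊` commutes with every generator** `ι(x E_{cd})`: the four sums of `gen_comm_casU` cancel in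
pairs by `frobenius_re`. Knapp 2002, Prop. 5.24. [folklore] -/
theorem gen_mul_casPlus (c d : Fin n) (x : ℂ) : gen c d x * casPlus n = casPlus n * gen c d x := by
  have hb : (∑ b, gen c b (x * 1) * gen b d 1 - ∑ b, gen c b 1 * gen b d (1 * x)) -
      (∑ b, gen c b (x * I) * gen b d I - ∑ b, gen c b I * gen b d (I * x)) = 0 := by
    rw [← Finset.sum_sub_distrib, ← Finset.sum_sub_distrib, ← Finset.sum_sub_distrib]
    exact Finset.sum_eq_zero fun b _ =>
      frobenius_re ((LinearMap.mul ℝ (UGL ℂ n)).compl₁₂ (gen c b) (gen b d)) x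
  have ha : (∑ a, gen a d 1 * gen c a (x * 1) - ∑ a, gen a d (1 * x) * gen c a 1) -
      (∑ a, gen a d I * gen c a (x * I) - ∑ a, gen a d (I * x) * gen c a I) = 0 := by
    rw [← Finset.sum_sub_distrib, ← Finset.sum_sub_distrib, ← Finset.sum_sub_distrib]
    exact Finset.sum_eq_zero fun a _ =>
      frobenius_re ((LinearMap.mul ℝ (UGL ℂ n)).compl₁₂ (gen a d) (gen c a)).flip x
  rw [← sub_eq_zero]
  calc gen c d x * casPlus n - casPlus n * gen c d x
      = (gen c d x * casU n 1 1 - casU n 1 1 * gen c d x) -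
          (gen c d x * casU n I I - casU n I I * gen c d x) := by rw [casPlus]; noncomm_ring
    _ = 0 := by rw [gen_comm_casU, gen_comm_casU]; exact sub_add_sub_aux hb ha

/-- **`C₋` commutes with every generator** (by `frobenius_im`). Knapp 2002, Prop. 5.24. [folklore] -/
theorem gen_mul_casMinus (c d : Fin n) (x : ℂ) :
    gen c d x * casMinus n = casMinus n * gen c d x := by
  have hb : (∑ b, gen c b (x * 1) * gen b d I - ∑ b, gen c b 1 * gen b d (I * x)) +
      (∑ b, gen c b (x * I) * gen b d 1 - ∑ b, gen c b I * gen b d (1 * x)) = 0 := by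
    rw [← Finset.sum_sub_distrib, ← Finset.sum_sub_distrib, ← Finset.sum_add_distrib]
    exact Finset.sum_eq_zero fun b _ =>
      frobenius_im ((LinearMap.mul ℝ (UGL ℂ n)).compl₁₂ (gen c b) (gen b d)) x
  have ha : (∑ a, gen a d 1 * gen c a (x * I) - ∑ a, gen a d (1 * x) * gen c a I) +
      (∑ a, gen a d I * gen c a (x * 1) - ∑ a, gen a d (I * x) * gen c a 1) = 0 := by
    rw [← Finset.sum_sub_distrib, ← Finset.sum_sub_distrib, ← Finset.sum_add_distrib]
    refine Finset.sum_eq_zero fun a _ => ?_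
    have h := frobenius_im ((LinearMap.mul ℝ (UGL ℂ n)).compl₁₂ (gen a d) (gen c a)).flip x
    simp only [LinearMap.flip_apply, LinearMap.compl₁₂_apply, LinearMap.mul_apply'] at h
    rwa [add_comm] at h
  rw [← sub_eq_zero]
  calc gen c d x * casMinus n - casMinus n * gen c d x
      = (gen c d x * casU n 1 I - casU n 1 I * gen c d x) +
          (gen c d x * casU n I 1 - casU n I 1 * gen c d x) := by rw [casMinus]; noncomm_ring
    _ = 0 := by rw [gen_comm_casU, gen_comm_casU]; exact add_add_add_aux hb ha

/-- An element of `U_ℝ(𝔤𝔩ₙ(ℂ))` commuting with all generators `ι(x E_{cd})` is central (they span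
`ι(𝔤𝔩ₙ(ℂ))` over `ℝ`; `Literature.Algebra.Lie.mem_center_of_forall_ι_comm`). [folklore] -/
theorem mem_center_of_forall_gen {C : UGL ℂ n}
    (h : ∀ (c d : Fin n) (x : ℂ), gen c d x * C = C * gen c d x) :
    C ∈ Subalgebra.center ℝ (UGL ℂ n) := by
  refine Literature.Algebra.Lie.mem_center_of_forall_ι_comm fun Y => ?_
  rw [Matrix.matrix_eq_sum_single Y, map_sum, Finset.sum_mul, Finset.mul_sum]
  refine Finset.sum_congr rfl fun a _ => ?_
  rw [map_sum, Finset.sum_mul, Finset.mul_sum]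
  exact Finset.sum_congr rfl fun b _ => h a b (Y a b)

variable (n) in
/-- **`C₊` is central in `U_ℝ(𝔤𝔩ₙ(ℂ))`.** Knapp 2002, Prop. 5.24. [folklore] -/
theorem casPlus_mem_center : casPlus n ∈ Subalgebra.center ℝ (UGL ℂ n) :=
  mem_center_of_forall_gen fun c d x => gen_mul_casPlus c d x

variable (n) in
/-- **`C₋` is central in `U_ℝ(𝔤𝔩ₙ(ℂ))`.** Knapp 2002, Prop. 5.24. [folklore] -/
theorem casMinus_mem_center : casMinus n ∈ Subalgebra.center ℝ (UGL ℂ n) :=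
  mem_center_of_forall_gen fun c d x => gen_mul_casMinus c d x

variable (n) in
/-- The central generator `Z(u) = ι(u · 1)` of `U_ℝ(𝔤𝔩ₙ(ℂ))` (`u ∈ ℂ`; `Z(1) = ι(1)`, `Z(i) = ι(i · 1)`).
[folklore] -/
def zedU (u : ℂ) : UGL ℂ n := ιU (u • (1 : Matrix (Fin n) (Fin n) ℂ))

variable (n) in
/-- **`Z(u)` is central in `U_ℝ(𝔤𝔩ₙ(ℂ))`** (`[X, u · 1] = 0` in `𝔤𝔩ₙ(ℂ)`). [folklore] -/
theorem zedU_mem_center (u : ℂ) : zedU n u ∈ Subalgebra.center ℝ (UGL ℂ n) := by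
  refine Literature.Algebra.Lie.mem_center_of_forall_ι_comm fun X => ?_
  have h : ιU ⁅X, u • (1 : Matrix (Fin n) (Fin n) ℂ)⁆ = 0 := by
    rw [Ring.lie_def, Matrix.mul_smul, Matrix.smul_mul, mul_one, one_mul, sub_self, map_zero]
  rw [LieHom.map_lie, Ring.lie_def, sub_eq_zero] at h
  exact h

end Central

/-! ### The central elements through a factorwise representation of `𝔤𝔩ₙ(ℂ)_ℂ` -/

section Lift

open HCSpan HCWt

variable {n : ℕ} {V : Type*} [AddCommGroup V] [Module ℂ V] (Ψ : FactorRep ℂ n V)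

/-- The **Casimir operator of the factor `τ`** of a factorwise representation `Ψ` of `𝔤𝔩ₙ(ℂ)_ℂ`:
`C_τ = ∑_{a,b} Ψ_τ(E_{ab}) Ψ_τ(E_{ba})`. Knapp 2002, (5.24). [folklore] -/
def cas (τ : ℂ →ₐ[ℝ] ℂ) : Module.End ℂ V :=
  ∑ a : Fin n, ∑ b : Fin n, Ψ.toFun τ (Matrix.single a b 1) * Ψ.toFun τ (Matrix.single b a 1)

/-- `ι(u E_{ab})` acts through the real form `ρ = ∑_τ Ψ_τ ∘ τ` by `∑_τ τ(u) Ψ_τ(E_{ab})`. [folklore] -/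
theorem lift_gen (a b : Fin n) (u : ℂ) :
    lift ℝ Ψ.rho (gen a b u) = ∑ τ : ℂ →ₐ[ℝ] ℂ, τ u • Ψ.toFun τ (Matrix.single a b 1) := by
  rw [gen_apply, lift_ι_apply, FactorRep.rho_apply]
  refine Finset.sum_congr rfl fun τ _ => ?_
  rw [FactorRep.mapMatrix_single, ← map_smul, Matrix.smul_single, smul_eq_mul, mul_one]

/-- `ι(u E_{ab}) ι(u' E_{cd})` acts by `∑_{τ,τ'} τ(u) τ'(u') Ψ_τ(E_{ab}) Ψ_τ'(E_{cd})`. [folklore] -/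
theorem lift_gen_mul_gen (a b c d : Fin n) (u u' : ℂ) :
    lift ℝ Ψ.rho (gen a b u * gen c d u') =
      ∑ τ : ℂ →ₐ[ℝ] ℂ, ∑ τ' : ℂ →ₐ[ℝ] ℂ,
        (τ u * τ' u') • (Ψ.toFun τ (Matrix.single a b 1) * Ψ.toFun τ' (Matrix.single c d 1)) := by
  rw [map_mul, lift_gen, lift_gen, Finset.sum_mul_sum]
  refine Finset.sum_congr rfl fun τ _ => Finset.sum_congr rfl fun τ' _ => ?_
  rw [smul_mul_smul_comm]

/-- The `(a, b)` summand of `C₊` acts by `2 (Ψ_id(E_{ab}) Ψ_id(E_{ba}) + Ψ_conj(E_{ab}) Ψ_conj(E_{ba}))`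
(the cross terms have coefficient `1 - τ(i) τ'(i) = 0`). [folklore] -/
theorem lift_casPlus_term (a b : Fin n) :
    lift ℝ Ψ.rho (gen a b 1 * gen b a 1) - lift ℝ Ψ.rho (gen a b I * gen b a I) =
      (2 : ℂ) • (Ψ.toFun σ⁺ (Matrix.single a b 1) * Ψ.toFun σ⁺ (Matrix.single b a 1) +
        Ψ.toFun σ⁻ (Matrix.single a b 1) * Ψ.toFun σ⁻ (Matrix.single b a 1)) := by
  rw [lift_gen_mul_gen, lift_gen_mul_gen]
  simp only [sum_algHom, map_one, conjAe_I, AlgHom.coe_id, id_eq, mul_neg, neg_mul, I_mul_I,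
    neg_neg, one_mul]
  module

/-- The `(a, b)` summand of `C₋` acts by `2i (Ψ_id(E_{ab}) Ψ_id(E_{ba}) - Ψ_conj(E_{ab}) Ψ_conj(E_{ba}))`
(the cross terms have coefficient `τ(i) + τ'(i) = 0`). [folklore] -/
theorem lift_casMinus_term (a b : Fin n) :
    lift ℝ Ψ.rho (gen a b 1 * gen b a I) + lift ℝ Ψ.rho (gen a b I * gen b a 1) =
      (2 * I) • (Ψ.toFun σ⁺ (Matrix.single a b 1) * Ψ.toFun σ⁺ (Matrix.single b a 1) -
        Ψ.toFun σ⁻ (Matrix.single a b 1) * Ψ.toFun σ⁻ (Matrix.single b a 1)) := by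
  rw [lift_gen_mul_gen, lift_gen_mul_gen]
  simp only [sum_algHom, map_one, conjAe_I, AlgHom.coe_id, id_eq, mul_one, one_mul]
  module

/-- **`C₊` acts through `ρ = ∑_τ Ψ_τ ∘ τ` by `2 (C_id + C_conj)`.** Knapp 2002, §V.4 and §VI.1.
[folklore] -/
theorem lift_casPlus : lift ℝ Ψ.rho (casPlus n) = (2 : ℂ) • (cas Ψ σ⁺ + cas Ψ σ⁻) := by
  rw [casPlus, casU, casU, map_sub]
  simp only [map_sum, cas]
  rw [← Finset.sum_sub_distrib, ← Finset.sum_add_distrib, Finset.smul_sum]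
  refine Finset.sum_congr rfl fun a _ => ?_
  rw [← Finset.sum_sub_distrib, ← Finset.sum_add_distrib, Finset.smul_sum]
  exact Finset.sum_congr rfl fun b _ => lift_casPlus_term Ψ a b

/-- **`C₋` acts through `ρ` by `2i (C_id - C_conj)`.** Knapp 2002, §V.4 and §VI.1. [folklore] -/
theorem lift_casMinus : lift ℝ Ψ.rho (casMinus n) = (2 * I) • (cas Ψ σ⁺ - cas Ψ σ⁻) := by
  rw [casMinus, casU, casU, map_add]
  simp only [map_sum, cas]
  rw [← Finset.sum_add_distrib, ← Finset.sum_sub_distrib, Finset.smul_sum]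
  refine Finset.sum_congr rfl fun a _ => ?_
  rw [← Finset.sum_add_distrib, ← Finset.sum_sub_distrib, Finset.smul_sum]
  exact Finset.sum_congr rfl fun b _ => lift_casMinus_term Ψ a b

/-- **`Z(u)` acts through `ρ` by `u Ψ_id(1) + ū Ψ_conj(1)`.** [folklore] -/
theorem lift_zedU (u : ℂ) :
    lift ℝ Ψ.rho (zedU n u) = u • Ψ.toFun σ⁺ 1 + conj u • Ψ.toFun σ⁻ 1 := by
  rw [zedU, lift_ι_apply, FactorRep.rho_apply, sum_algHom, mapMatrix_smul, mapMatrix_smul, map_smul,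
    map_smul, map_one (σ⁺).mapMatrix, map_one (σ⁻).mapMatrix]
  rfl

/-- The centre of a factor on a highest weight vector (`n = 2`): `Ψ_τ(1) v = (l_{τ,0} + l_{τ,1}) v`.
[folklore] -/
theorem one_apply_of_isHighestWeightVector {W : Type*} [AddCommGroup W] [Module ℂ W]
    (Φ : FactorRep ℂ 2 W) {l : ArchWeightGL ℂ 2} {v : W} (hv : IsHighestWeightVector Φ.rho l v)
    (τ : ℂ →ₐ[ℝ] ℂ) : Φ.toFun τ 1 v = (l τ 0 + l τ 1) • v := by
  have h1 : (1 : Matrix (Fin 2) (Fin 2) ℂ) = Matrix.single 0 0 1 + Matrix.single 1 1 1 := by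
    ext i j
    fin_cases i <;> fin_cases j <;> simp
  rw [h1, map_add, LinearMap.add_apply]
  change Φ.E τ 0 0 v + Φ.E τ 1 1 v = _
  rw [Φ.E_diag_apply hv τ 0, Φ.E_diag_apply hv τ 1, add_smul]

end Lift

/-! ### The factorisation of a real representation of `𝔤𝔩ₙ(ℂ)` through `𝔤𝔩ₙ(ℂ) ⊗_ℝ ℂ` -/

section Factor

variable {n : ℕ} {V : Type*} [AddCommGroup V] [Module ℂ V]
  (ρ : Matrix (Fin n) (Fin n) ℂ →ₗ⁅ℝ⁆ Module.End ℂ V)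

/-- The **`τ`-projector** of a real representation `ρ` of `𝔤𝔩ₙ(ℂ)` on a complex space, as an operator:
`P_τ(X) = ½ (ρ X + conj(τ i) ρ(i X))`, i.e. `P_id X = ½ (ρ X - i ρ(iX))`, `P_conj X = ½ (ρ X + i ρ(iX))`
(the operator form of `HCEmb.proj`, `tauProj_apply`). Knapp 2002, §VI.1. [folklore] -/
def tauProj (τ : ℂ →ₐ[ℝ] ℂ) (X : Matrix (Fin n) (Fin n) ℂ) : Module.End ℂ V :=
  (2 : ℂ)⁻¹ • (ρ X + conj (τ I) • ρ (I • X))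

/-- `Z ↦ ρ Z v` as a real-linear map (to apply the `τ`-projector calculus of `HCEmb`). [folklore] -/
def evalAt (v : V) : Matrix (Fin n) (Fin n) ℂ →ₗ[ℝ] V where
  toFun Z := ρ Z v
  map_add' Z Z' := by rw [map_add, LinearMap.add_apply]
  map_smul' r Z := by rw [map_smul, LinearMap.smul_apply, RingHom.id_apply]

/-- The operator `τ`-projector applied to a vector is the `τ`-projector `HCEmb.proj` of `Z ↦ ρ Z v`.
[folklore] -/
theorem tauProj_apply (τ : ℂ →ₐ[ℝ] ℂ) (X : Matrix (Fin n) (Fin n) ℂ) (v : V) :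
    tauProj ρ τ X v = HCEmb.proj (evalAt ρ v) τ X := by
  rw [HCEmb.proj_def, HCEmb.card_algHom_of_im_I (𝕜 := ℂ) (by simp), Nat.cast_ofNat]
  rfl

/-- Additivity of the `τ`-projector. [folklore] -/
theorem tauProj_add (τ : ℂ →ₐ[ℝ] ℂ) (X Y : Matrix (Fin n) (Fin n) ℂ) :
    tauProj ρ τ (X + Y) = tauProj ρ τ X + tauProj ρ τ Y := by
  simp only [tauProj, smul_add, map_add]
  abel

/-- **`τ`-semilinearity** of the `τ`-projector (`HCEmb.proj_smul`): `P_τ(a X) = τ(a) P_τ(X)`. [folklore] -/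
theorem tauProj_smul (τ : ℂ →ₐ[ℝ] ℂ) (a : ℂ) (X : Matrix (Fin n) (Fin n) ℂ) :
    tauProj ρ τ (a • X) = τ a • tauProj ρ τ X := by
  refine LinearMap.ext fun v => ?_
  rw [LinearMap.smul_apply, tauProj_apply, tauProj_apply]
  exact HCEmb.proj_smul (evalAt ρ v) τ a X

/-- **The commutator of two projectors**: `[P_τ X, P_τ' Y] = ¼ ((1 - c c') ρ[X,Y] + (c + c') ρ(i[X,Y]))`
with `c = conj(τ i)`, `c' = conj(τ' i)` — from `ρ` being a REAL Lie algebra homomorphism and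
`i[X,Y] = [iX,Y] = [X,iY]`, `[iX,iY] = -[X,Y]` in `𝔤𝔩ₙ(ℂ)`. Knapp 2002, §VI.1. [folklore] -/
theorem tauProj_mul_tauProj_sub (τ τ' : ℂ →ₐ[ℝ] ℂ) (X Y : Matrix (Fin n) (Fin n) ℂ) :
    tauProj ρ τ X * tauProj ρ τ' Y - tauProj ρ τ' Y * tauProj ρ τ X =
      ((2 : ℂ)⁻¹ * 2⁻¹) • ((1 - conj (τ I) * conj (τ' I)) • ρ ⁅X, Y⁆ +
        (conj (τ I) + conj (τ' I)) • ρ (I • ⁅X, Y⁆)) := by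
  refine LinearMap.ext fun v => ?_
  have hI : I • ⁅X, Y⁆ = ⁅X, I • Y⁆ := by
    simp only [Ring.lie_def, Matrix.mul_smul, Matrix.smul_mul, smul_sub]
  have hI' : ⁅I • X, Y⁆ = ⁅X, I • Y⁆ := by
    simp only [Ring.lie_def, Matrix.mul_smul, Matrix.smul_mul]
  have hII : ⁅I • X, I • Y⁆ = -⁅X, Y⁆ := by
    simp only [Ring.lie_def, Matrix.mul_smul, Matrix.smul_mul, smul_smul, I_mul_I, neg_smul, one_smul]
    abel
  have r1 : ρ ⁅X, Y⁆ v = ρ X (ρ Y v) - ρ Y (ρ X v) := by rw [LieHom.map_lie, Ring.lie_def]; rfl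
  have r2 : ρ (I • ⁅X, Y⁆) v = ρ X (ρ (I • Y) v) - ρ (I • Y) (ρ X v) := by
    rw [hI, LieHom.map_lie, Ring.lie_def]; rfl
  have r3 : ρ (I • X) (ρ Y v) = ρ X (ρ (I • Y) v) - ρ (I • Y) (ρ X v) + ρ Y (ρ (I • X) v) := by
    have h := LieHom.map_lie ρ (I • X) Y
    rw [hI', LieHom.map_lie, Ring.lie_def, Ring.lie_def] at h
    have h' := LinearMap.congr_fun h v
    simp only [LinearMap.sub_apply, Module.End.mul_apply] at h'
    exact sub_eq_iff_eq_add.mp h'.symm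
  have r4 : ρ (I • X) (ρ (I • Y) v) = ρ (I • Y) (ρ (I • X) v) - (ρ X (ρ Y v) - ρ Y (ρ X v)) := by
    have h := LieHom.map_lie ρ (I • X) (I • Y)
    rw [hII, map_neg, LieHom.map_lie, Ring.lie_def, Ring.lie_def] at h
    have h' := LinearMap.congr_fun h v
    simp only [LinearMap.neg_apply, LinearMap.sub_apply, Module.End.mul_apply] at h'
    rw [sub_eq_iff_eq_add.mp h'.symm]
    abel
  simp only [LinearMap.sub_apply, Module.End.mul_apply, LinearMap.smul_apply, LinearMap.add_apply,
    tauProj, map_add, map_smul, smul_add, r1, r2]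
  rw [r3, r4]
  module

/-- **Each projector is a Lie algebra homomorphism up to `τ`**: `P_τ [X,Y] = [P_τ X, P_τ Y]`
(`c = c'`, `c² = -1` in `tauProj_mul_tauProj_sub`). [folklore] -/
theorem tauProj_lie (τ : ℂ →ₐ[ℝ] ℂ) (X Y : Matrix (Fin n) (Fin n) ℂ) :
    tauProj ρ τ ⁅X, Y⁆ = tauProj ρ τ X * tauProj ρ τ Y - tauProj ρ τ Y * tauProj ρ τ X := by
  rw [tauProj_mul_tauProj_sub, conj_algHom_I_mul_self, tauProj]
  module

/-- **Different projectors commute**: `P_τ X P_τ' Y = P_τ' Y P_τ X` for `τ ≠ τ'` (`c' = -c`). [folklore] -/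
theorem tauProj_comm {τ τ' : ℂ →ₐ[ℝ] ℂ} (h : τ ≠ τ') (X Y : Matrix (Fin n) (Fin n) ℂ) :
    tauProj ρ τ X * tauProj ρ τ' Y = tauProj ρ τ' Y * tauProj ρ τ X := by
  rw [← sub_eq_zero, tauProj_mul_tauProj_sub, algHom_I_eq_neg h, map_neg, mul_neg,
    conj_algHom_I_mul_self, neg_neg, sub_self, add_neg_cancel, zero_smul, zero_smul, add_zero,
    smul_zero]

/-- `P_id X + P_conj X = ρ X` (`HCEmb.sum_proj`). [folklore] -/
theorem tauProj_add_tauProj (X : Matrix (Fin n) (Fin n) ℂ) :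
    tauProj ρ σ⁺ X + tauProj ρ σ⁻ X = ρ X := by
  simp only [tauProj, conjAe_I, map_neg, AlgHom.coe_id, id_eq, conj_I, neg_neg]
  module

/-- **The factorisation `Φ = ofRho ρ` of a real representation `ρ` of `𝔤𝔩ₙ(ℂ)`** through the
complexification `𝔤𝔩ₙ(ℂ) ⊗_ℝ ℂ ≅ ∏_{τ ∈ {id, conj}} 𝔤𝔩ₙ(ℂ)`: the commuting complex-linear Lie algebra
homomorphisms `Φ_τ(Y) = P_τ(τ Y)`, i.e. `L = Φ_id : X ↦ ½ (ρ X - i ρ(iX))` and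
`R = Φ_conj : Y ↦ ½ (ρ Ȳ + i ρ(i Ȳ))`, a factorwise representation (`HCWt.FactorRep`) whose real form
`X ↦ ∑_τ Φ_τ(τ X)` is `ρ` (`ofRho_rho`). Knapp 2002, §VI.1. [folklore] -/
def ofRho : HCWt.FactorRep ℂ n V where
  toFun τ :=
    { toFun := fun Y => tauProj ρ τ (τ.mapMatrix Y)
      map_add' := fun X Y => by simp only [map_add, tauProj_add]
      map_smul' := fun a Y => by
        rw [RingHom.id_apply, mapMatrix_smul, tauProj_smul, algHom_algHom]
      map_lie' := fun {X Y} => by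
        show tauProj ρ τ (τ.mapMatrix ⁅X, Y⁆) =
          ⁅tauProj ρ τ (τ.mapMatrix X), tauProj ρ τ (τ.mapMatrix Y)⁆
        rw [mapMatrix_lie, tauProj_lie, Ring.lie_def] }
  commute τ τ' h X Y := tauProj_comm ρ h _ _

/-- Unfolding `ofRho`. [folklore] -/
theorem ofRho_apply (τ : ℂ →ₐ[ℝ] ℂ) (Y : Matrix (Fin n) (Fin n) ℂ) :
    (ofRho ρ).toFun τ Y = tauProj ρ τ (τ.mapMatrix Y) := rfl

/-- **The real form of the factorisation is `ρ`**: `ρ X = ∑_τ Φ_τ(τ X)`. Knapp 2002, §VI.1. [folklore] -/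
theorem ofRho_rho : (ofRho ρ).rho = ρ := by
  refine LieHom.ext fun X => ?_
  rw [HCWt.FactorRep.rho_apply, sum_algHom, ofRho_apply, ofRho_apply, mapMatrix_mapMatrix,
    mapMatrix_mapMatrix, tauProj_add_tauProj]

/-- `ρ X = L X + R X̄` with `L = Φ_id`, `R = Φ_conj`. Knapp 2002, §VI.1. [folklore] -/
theorem rho_eq_add (X : Matrix (Fin n) (Fin n) ℂ) :
    ρ X = (ofRho ρ).toFun σ⁺ X + (ofRho ρ).toFun σ⁻ (X.map (starRingEnd ℂ)) := by
  have h : (σ⁻).mapMatrix (X.map (starRingEnd ℂ)) = X := by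
    ext i j
    simp only [AlgHom.mapMatrix_apply, Matrix.map_apply]
    exact Complex.conj_conj _
  have h' : (σ⁺).mapMatrix X = X := by ext i j; rfl
  rw [ofRho_apply, ofRho_apply, h, h', tauProj_add_tauProj]

end Factor

end GLnComplexCasimir

namespace GL2ComplexCasimir

open GLnComplexCasimir

/-- The conjugation `ℂ → ℂ` as a real algebra homomorphism (local notation). -/
local notation "σ⁻" => (Complex.conjAe : ℂ →ₐ[ℝ] ℂ)
/-- The identity `ℂ → ℂ` as a real algebra homomorphism (local notation). -/
local notation "σ⁺" => AlgHom.id ℝ ℂ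

/-! ### `n = 2`: the Harish-Chandra polynomials of `C₊`, `C₋`, `Z(u)` -/

section Two

open HCSpan HCWt

variable {V : Type*} [AddCommGroup V] [Module ℂ V] (Ψ : FactorRep ℂ 2 V) {l : ArchWeightGL ℂ 2} {v : V}

/-- **The Casimir operator of a factor on a highest weight vector** of weight `l`:
`C_τ v = (l_{τ,0}² + l_{τ,1}² + l_{τ,0} - l_{τ,1}) v` (`E₀₁ v = 0`, `E₀₁E₁₀ v = (E₀₀ - E₁₁) v`), as in
`GL2Casimir.lift_casimir_apply_of_isHighestWeightVector`. Knapp 2002, §V.5, (5.43). [folklore] -/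
theorem cas_apply_of_isHighestWeightVector (hv : IsHighestWeightVector Ψ.rho l v) (τ : ℂ →ₐ[ℝ] ℂ) :
    cas Ψ τ v = (l τ 0 ^ 2 + l τ 1 ^ 2 + l τ 0 - l τ 1) • v := by
  have h00 : Ψ.E τ 0 0 v = l τ 0 • v := Ψ.E_diag_apply hv τ 0
  have h11 : Ψ.E τ 1 1 v = l τ 1 • v := Ψ.E_diag_apply hv τ 1
  have h01 : Ψ.E τ 0 1 v = 0 := Ψ.E_apply_eq_zero hv τ (show (0 : Fin 2) < 1 by decide)
  have hbr : Ψ.E τ 0 1 (Ψ.E τ 1 0 v) = (l τ 0 - l τ 1) • v := by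
    have h := LinearMap.congr_fun (Ψ.E_mul_E_sub τ 0 1 1 0) v
    simp only [LinearMap.sub_apply, Module.End.mul_apply, h01, map_zero, sub_zero, if_true] at h
    rw [h, h00, h11, sub_smul]
  simp only [cas, Fin.sum_univ_two, LinearMap.add_apply, Module.End.mul_apply]
  change Ψ.E τ 0 0 (Ψ.E τ 0 0 v) + Ψ.E τ 0 1 (Ψ.E τ 1 0 v) +
    (Ψ.E τ 1 0 (Ψ.E τ 0 1 v) + Ψ.E τ 1 1 (Ψ.E τ 1 1 v)) = _
  rw [h00, map_smul, h00, hbr, h01, map_zero, zero_add, h11, map_smul, h11, smul_smul, smul_smul,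
    ← add_smul, ← add_smul]
  congr 1
  ring

/-- A central `z` acts on the highest weight vector `hwVec (x - ρ)` of the model of `HarishChandraGLModel`
by `γ(z)(x)` (the highest weight axiom of a Harish-Chandra homomorphism `γ`). [folklore] -/
theorem lift_model_hwVec (γ : HarishChandraHomGL ℂ 2) (x : (ℂ →ₐ[ℝ] ℂ) → Fin 2 → ℂ)
    (z : Subalgebra.center ℝ (UGL ℂ 2)) :
    lift ℝ (HCModel.modelRep ℂ 2).rho (z : UGL ℂ 2)
        (HCModel.hwVec (𝕜 := ℂ) fun σ i => x σ i - rhoGL 2 i) =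
      MvPolynomial.aeval (fun p : (ℂ →ₐ[ℝ] ℂ) × Fin 2 => x p.1 p.2) (γ.toAlgHom z) •
        HCModel.hwVec (𝕜 := ℂ) fun σ i => x σ i - rhoGL 2 i := by
  have key := γ.highestWeight _ (HCModel.modelRep ℂ 2).rho (fun σ i => x σ i - rhoGL 2 i)
    (HCModel.hwVec fun σ i => x σ i - rhoGL 2 i)
    (HCModel.isHighestWeightVector_hwVec (𝕜 := ℂ) (n := 2) _) z
  have hx : (fun p : (ℂ →ₐ[ℝ] ℂ) × Fin 2 => x p.1 p.2 - rhoGL 2 p.2 + rhoGL 2 p.2) =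
      fun p => x p.1 p.2 := by
    funext p; simp
  rwa [hx] at key

/-- **The Harish-Chandra polynomial of `C₊`** is `2 ∑_τ (x_{τ,0}² + x_{τ,1}² - ½)` (evaluate on the highest
weight vector of weight `x - ρ` of the model, `ρ = (½, -½)`). Knapp 2002, Thm. 5.44.
[cite: Knapp2002, Thm. 5.44] -/
theorem aeval_hc_casPlus (γ : HarishChandraHomGL ℂ 2) (x : (ℂ →ₐ[ℝ] ℂ) → Fin 2 → ℂ) :
    MvPolynomial.aeval (fun p : (ℂ →ₐ[ℝ] ℂ) × Fin 2 => x p.1 p.2)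
        (γ.toAlgHom ⟨casPlus 2, casPlus_mem_center 2⟩) =
      2 * ((x σ⁺ 0 ^ 2 + x σ⁺ 1 ^ 2 - 1 / 2) + (x σ⁻ 0 ^ 2 + x σ⁻ 1 ^ 2 - 1 / 2)) := by
  have hv := HCModel.isHighestWeightVector_hwVec (𝕜 := ℂ) (n := 2) fun σ i => x σ i - rhoGL 2 i
  have key := lift_model_hwVec γ x ⟨casPlus 2, casPlus_mem_center 2⟩
  change lift ℝ (HCModel.modelRep ℂ 2).rho (casPlus 2) _ = _ at key
  rw [lift_casPlus, LinearMap.smul_apply, LinearMap.add_apply,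
    cas_apply_of_isHighestWeightVector _ hv, cas_apply_of_isHighestWeightVector _ hv, ← add_smul,
    smul_smul] at key
  rw [← smul_hwVec_injective (𝕜 := ℂ) (n := 2) _ key]
  simp only [GL2Casimir.rhoGL_two_zero, GL2Casimir.rhoGL_two_one]
  ring

/-- **The Harish-Chandra polynomial of `C₋`** is
`2i ((x_{id,0}² + x_{id,1}² - ½) - (x_{conj,0}² + x_{conj,1}² - ½))`. Knapp 2002, Thm. 5.44.
[cite: Knapp2002, Thm. 5.44] -/
theorem aeval_hc_casMinus (γ : HarishChandraHomGL ℂ 2) (x : (ℂ →ₐ[ℝ] ℂ) → Fin 2 → ℂ) :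
    MvPolynomial.aeval (fun p : (ℂ →ₐ[ℝ] ℂ) × Fin 2 => x p.1 p.2)
        (γ.toAlgHom ⟨casMinus 2, casMinus_mem_center 2⟩) =
      2 * I * ((x σ⁺ 0 ^ 2 + x σ⁺ 1 ^ 2 - 1 / 2) - (x σ⁻ 0 ^ 2 + x σ⁻ 1 ^ 2 - 1 / 2)) := by
  have hv := HCModel.isHighestWeightVector_hwVec (𝕜 := ℂ) (n := 2) fun σ i => x σ i - rhoGL 2 i
  have key := lift_model_hwVec γ x ⟨casMinus 2, casMinus_mem_center 2⟩
  change lift ℝ (HCModel.modelRep ℂ 2).rho (casMinus 2) _ = _ at key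
  rw [lift_casMinus, LinearMap.smul_apply, LinearMap.sub_apply,
    cas_apply_of_isHighestWeightVector _ hv, cas_apply_of_isHighestWeightVector _ hv, ← sub_smul,
    smul_smul] at key
  rw [← smul_hwVec_injective (𝕜 := ℂ) (n := 2) _ key]
  simp only [GL2Casimir.rhoGL_two_zero, GL2Casimir.rhoGL_two_one]
  ring

/-- **The Harish-Chandra polynomial of `Z(u)`** is `u (x_{id,0} + x_{id,1}) + ū (x_{conj,0} + x_{conj,1})`.
Knapp 2002, Thm. 5.44. [cite: Knapp2002, Thm. 5.44] -/
theorem aeval_hc_zedU (γ : HarishChandraHomGL ℂ 2) (x : (ℂ →ₐ[ℝ] ℂ) → Fin 2 → ℂ) (u : ℂ) :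
    MvPolynomial.aeval (fun p : (ℂ →ₐ[ℝ] ℂ) × Fin 2 => x p.1 p.2)
        (γ.toAlgHom ⟨zedU 2 u, zedU_mem_center 2 u⟩) =
      u * (x σ⁺ 0 + x σ⁺ 1) + conj u * (x σ⁻ 0 + x σ⁻ 1) := by
  have hv := HCModel.isHighestWeightVector_hwVec (𝕜 := ℂ) (n := 2) fun σ i => x σ i - rhoGL 2 i
  have key := lift_model_hwVec γ x ⟨zedU 2 u, zedU_mem_center 2 u⟩
  change lift ℝ (HCModel.modelRep ℂ 2).rho (zedU 2 u) _ = _ at key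
  rw [lift_zedU, LinearMap.add_apply, LinearMap.smul_apply, LinearMap.smul_apply,
    one_apply_of_isHighestWeightVector _ hv, one_apply_of_isHighestWeightVector _ hv, smul_smul,
    smul_smul, ← add_smul] at key
  rw [← smul_hwVec_injective (𝕜 := ℂ) (n := 2) _ key]
  simp only [GL2Casimir.rhoGL_two_zero, GL2Casimir.rhoGL_two_one]
  ring

end Two

/-! ### The scalars on a module with a Harish-Chandra parameter -/

section Main

open HCSpan HCWt

variable {V : Type*} [AddCommGroup V] [Module ℂ V]
  (ρ : Matrix (Fin 2) (Fin 2) ℂ →ₗ⁅ℝ⁆ Module.End ℂ V)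

/-- Cancelling a non-zero scalar: `c A = (c d) · 1 ⟹ A = d · 1`. [folklore] -/
theorem eq_smul_one_of_smul_eq {c d : ℂ} (hc : c ≠ 0) {A : Module.End ℂ V}
    (h : c • A = algebraMap ℂ (Module.End ℂ V) (c * d)) : A = d • (1 : Module.End ℂ V) := by
  rw [Algebra.algebraMap_eq_smul_one, mul_smul] at h
  have h' := congrArg (fun T : Module.End ℂ V => c⁻¹ • T) h
  simp only [smul_smul, inv_mul_cancel₀ hc, one_smul, inv_mul_cancel_left₀ hc] at h'
  exact h'

/-- Solving `A + B = (a + b) · 1`, `A - B = (a - b) · 1`. [folklore] -/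
theorem eq_smul_one_of_add_of_sub {A B : Module.End ℂ V} {a b : ℂ}
    (h₁ : A + B = (a + b) • (1 : Module.End ℂ V)) (h₂ : A - B = (a - b) • (1 : Module.End ℂ V)) :
    A = a • (1 : Module.End ℂ V) ∧ B = b • (1 : Module.End ℂ V) := by
  constructor
  · calc A = (2 : ℂ)⁻¹ • ((A + B) + (A - B)) := by module
      _ = a • (1 : Module.End ℂ V) := by rw [h₁, h₂]; module
  · calc B = (2 : ℂ)⁻¹ • ((A + B) - (A - B)) := by module
      _ = b • (1 : Module.End ℂ V) := by rw [h₁, h₂]; module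

/-- **The scalars of the two factors on a `𝔤𝔩₂(ℂ)`-module of Harish-Chandra parameter `χ`** with
`χ(id) = {s₁, s₂}`, `χ(conj) = {t₁, t₂}`: `L(1) = s₁ + s₂`, `R(1) = t₁ + t₂`, `C_L = s₁² + s₂² - ½`,
`C_R = t₁² + t₂² - ½`. The central elements `Z(1)`, `Z(i)`, `C₊`, `C₋` act through the infinitesimal
character by their Harish-Chandra polynomials at the enumeration `l(id) = (s₁, s₂)`, `l(conj) = (t₁, t₂)`
of `χ`, i.e. by `(s₁+s₂) + (t₁+t₂)`, `i((s₁+s₂) - (t₁+t₂))`, `2(α + β)`, `2i(α - β)`, and in `ρ` by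
`L1 + R1`, `i(L1 - R1)`, `2(C_L + C_R)`, `2i(C_L - C_R)`. Knapp 2002, Thm. 5.44. [cite: Knapp2002, Thm. 5.44] -/
theorem scalars_of_hasHCParameter {χ : (ℂ →ₐ[ℝ] ℂ) → Multiset ℂ} (hχ : HasHCParameter ρ χ)
    {s₁ s₂ t₁ t₂ : ℂ} (hs : χ σ⁺ = {s₁, s₂}) (ht : χ σ⁻ = {t₁, t₂}) :
    ((ofRho ρ).toFun σ⁺ 1 = (s₁ + s₂) • (1 : Module.End ℂ V) ∧
      (ofRho ρ).toFun σ⁻ 1 = (t₁ + t₂) • (1 : Module.End ℂ V)) ∧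
    (cas (ofRho ρ) σ⁺ = (s₁ ^ 2 + s₂ ^ 2 - 1 / 2) • (1 : Module.End ℂ V) ∧
      cas (ofRho ρ) σ⁻ = (t₁ ^ 2 + t₂ ^ 2 - 1 / 2) • (1 : Module.End ℂ V)) := by
  classical
  obtain ⟨-, θ, hθ, hγ⟩ := hχ
  rw [← ofRho_rho ρ] at hθ
  set l : (ℂ →ₐ[ℝ] ℂ) → Fin 2 → ℂ := fun τ => if τ = σ⁺ then ![s₁, s₂] else ![t₁, t₂] with hl
  have hl0 : l σ⁺ = ![s₁, s₂] := if_pos rfl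
  have hl1 : l σ⁻ = ![t₁, t₂] := if_neg id_ne_conjAe.symm
  have hlχ : ∀ τ, Finset.univ.val.map (l τ) = χ τ := fun τ => by
    rcases Complex.real_algHom_eq_id_or_conj τ with rfl | rfl
    · rw [hl0, GL2Casimir.univ_val_map_vecCons, hs]
    · rw [hl1, GL2Casimir.univ_val_map_vecCons, ht]
  have hval : ∀ z : Subalgebra.center ℝ (UGL ℂ 2), lift ℝ (ofRho ρ).rho (z : UGL ℂ 2) =
      algebraMap ℂ (Module.End ℂ V)
        (MvPolynomial.aeval (fun p : (ℂ →ₐ[ℝ] ℂ) × Fin 2 => l p.1 p.2)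
          ((harishChandraHomGL ℂ 2).toAlgHom z)) :=
    fun z => by rw [hθ z, hγ (harishChandraHomGL ℂ 2) l hlχ z]
  -- the centre: `Z(1) = L1 + R1`, `Z(i) = i (L1 - R1)`
  have hz1 := hval ⟨zedU 2 1, zedU_mem_center 2 1⟩
  have hzI := hval ⟨zedU 2 I, zedU_mem_center 2 I⟩
  rw [aeval_hc_zedU] at hz1 hzI
  rw [lift_zedU, hl0, hl1, map_one (starRingEnd ℂ), one_smul, one_smul, one_mul, one_mul,
    Algebra.algebraMap_eq_smul_one] at hz1
  rw [lift_zedU, hl0, hl1, conj_I, neg_smul, neg_mul, ← sub_eq_add_neg, ← sub_eq_add_neg,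
    ← smul_sub, ← mul_sub] at hzI
  simp only [Matrix.cons_val_zero, Matrix.cons_val_one] at hz1 hzI
  -- the Casimir elements: `C₊ = 2 (C_L + C_R)`, `C₋ = 2i (C_L - C_R)`
  have hP := hval ⟨casPlus 2, casPlus_mem_center 2⟩
  have hM := hval ⟨casMinus 2, casMinus_mem_center 2⟩
  rw [aeval_hc_casPlus, lift_casPlus, hl0, hl1] at hP
  rw [aeval_hc_casMinus, lift_casMinus, hl0, hl1] at hM
  simp only [Matrix.cons_val_zero, Matrix.cons_val_one] at hP hM
  exact ⟨eq_smul_one_of_add_of_sub hz1 (eq_smul_one_of_smul_eq I_ne_zero hzI),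
    eq_smul_one_of_add_of_sub (eq_smul_one_of_smul_eq two_ne_zero hP)
      (eq_smul_one_of_smul_eq (mul_ne_zero two_ne_zero I_ne_zero) hM)⟩

end Main

end GL2ComplexCasimir

end Literature.NumberTheory.Automorphic

end
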